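import Summits.Parity.GeneralizedHardyLittlewood.Theses.LiouvilleMAD
import Summits.Parity.GeneralizedHardyLittlewood.Theses.LiouvilleShiftedTables
import Summits.Parity.GeneralizedHardyLittlewood.Theses.DicksonFibration
import Summits.Parity.GeneralizedHardyLittlewood.Theorems.LiouvilleMADEngineToGHL
import Summits.Parity.GeneralizedHardyLittlewood.Theorems.LiouvilleMADEngineToGHLPairsReach
import Summits.Parity.GeneralizedHardyLittlewood.Theorems.LiouvilleMADEngineToGHLStubRungWeights
import Summits.Parity.GeneralizedHardyLittlewood.Theorems.LiouvilleMADEngineToGHLStubRungEuler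
import Summits.Parity.GeneralizedHardyLittlewood.Theorems.LiouvilleMADEngineToGHLStubRungLarge
import Summits.Parity.GeneralizedHardyLittlewood.Theorems.LiouvilleMADEngineToGHLStubRungAssembly
import Summits.Parity.GeneralizedHardyLittlewood.Theorems.LiouvilleMADEngineToGHLTupleLadder
import Summits.Parity.GeneralizedHardyLittlewood.Theorems.LiouvilleMADEngineToGHLStubReachDictionary
import Summits.Parity.GeneralizedHardyLittlewood.Theorems.LiouvilleMADEngineToGHLStubReachSingular
import Summits.Parity.GeneralizedHardyLittlewood.Theorems.LiouvilleMADEngineToGHLStubHlTuplesUniform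
import Summits.Parity.GeneralizedHardyLittlewood.Theorems.LiouvilleMADEngineToGHLStubTuplesReach
import Summits.Parity.GeneralizedHardyLittlewood.Theorems.LiouvilleMADEngineToGHLTuplesReach
import Summits.Parity.GeneralizedHardyLittlewood.Theorems.LeeYangFibresPrimeCellsRelativeDimOneOne
import Summits.Parity.GeneralizedHardyLittlewood.Theorems.LeeYangFibresPrimeCellsRelativeHardyLittlewoodDictionary

/-!
# Line `tuple_ladder` for the crux `EngineToGHL` (stmt-Parity-14995, route LiouvilleMAD) — skeleton v6 (lead c6)

Strategist line (cstrat-stmt-Parity-14995, 2026-08-17), led by prover c5 (cycles 1–2) and c6 (cycle 3).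

**Cycle 3 (lead c6, 2026-08-17) — ALIGNMENT with the sibling crux.** `EngineToGHL ↔ PairsToGHL` (stmt-Parity-9389) with
NO hypothesis (`Theorems.EngineToGHL.engineToGHL_iff_pairsToGHL`), and since 02:11Z the crux store of 9389 carries the
strategist line `Cruxes/PairsToGHL/Lines/sloped_ladder.lean` (lead c3 live): the SAME Bombieri ladder over all fixed
positive sloped systems, base `t = 1` (a theorem), which NESTS this line.  So that one set of conjecture-grade inputs
serves both cruxes, the two inputs of THIS skeleton are now the sloped ladder's inputs VERBATIM
(`stub_slopedLevelInput` = 9389's `stub_slopedLevel`, `stub_slopedAtomsInput` = 9389's `stub_slopedAtoms`), and the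
unit-slope inputs of v5 (`tupleLevel`, `tupleAtoms`, the registered texts of the former `stub_tupleLevel`,
`stub_tupleAtoms`) are DERIVED from them through two theorem-grade transfer lemmas `tupleLevelOfSloped`,
`tupleAtomsOfSloped` (instantiate at the translate system `n + hⱼ` of `H`; LANDED p141122,
`Theorems/LiouvilleMADEngineToGHLSlopedInputs.lean`).  Open stubs: `stub_slopedLevelInput`, `stub_slopedAtomsInput`, `stub_reachToDimOneTwo` — all conjecture-grade.  The residual lost its provable `t = 1` layer: `stub_reachToDimOneTwo`
is `Reach → DimOne` for `t ≥ 2` only, the `t = 1` case of `DimOne` being the tree theorem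
`Cruxes.PrimeCellsRelative.Sketch.stub_dimOne_one` (Green–Tao Thm. 4.5 at level 1, proved).  Nothing theorem-grade and
open is registered here that the 9389 lead is working (its rung `stub_slopedRung`, `stub_toBounded`): no duplicate seats.

**Cycle 1 (done).** The theorem-grade stub `stub_tupleLadder` (THE RUNG: for `t ≥ 2`, `HL ∧ Level ∧ Atoms` on
`t`-sets `∋ 0` ⇒ `HL` on `(t+1)`-sets `∋ 0`) was reshaped into four pieces, ALL LANDED (wave 1, 2026-08-17):
`Theorems.EngineToGHL.TupleLadder.stub_rungWeights` (p138024), `stub_rungEuler` (p138333), `stub_rungLarge` (p139183,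
Aux p138987), `stub_rungAssembly` (p138017); the rung `tupleLadder_rung` is derived below sorry-free (landed as
`Theorems.EngineToGHL.TupleLadder.tupleLadder_rung`, p139876).

**Cycle 2 (done).** The residual `stub_tuplesToDimOne` (`Tuples → DimOne`) was reshaped: its PROVABLE part —
the exact reach of the tuples conjecture inside `DicksonFibration.DimOne`, namely the Green–Tao asymptotic for every
UNIT-SLOPE system `ψᵢ(n) = n + bᵢ` of every length `t ≥ 2` with BOUNDED shift differences `|bᵢ - bⱼ| ≤ Hb`, uniformly
in `|bᵢ| ≤ L N` and over all convex `K ⊆ [-N, N]` (the `t = 2` case is c1's `pairsReach_of_pairsHL`) — became four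
theorem-grade stubs, ALL LANDED (wave 2, 2026-08-17: `stub_reachDictionary` p140062, `stub_reachSingular` p140069,
`stub_hlTuplesUniform` p140011, `stub_tuplesReach` p140223; the composite `tuplesReach_of_hlTuples` lands as
`Theorems/LiouvilleMADEngineToGHLTuplesReach.lean`), and
what is NOT reached — non-unit SLOPES and SHIFT-UNIFORMITY (differences up to `2 L N`, the Landau–Siegel-complete
layer) — is the new residual `stub_reachToDimOne : Reach → DimOne`, again strictly weaker than the crux
(`reachToDimOne_of_engineToGHL`).  The conjecture-grade inputs `stub_tupleLevel`, `stub_tupleAtoms` are unchanged.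
Sorries live only in `stub_*`; `EngineToGHL_closed` concludes the crux by name.

Notation, for `H ⊆ ℕ` finite with `0 ∈ H`:
* `HL(H)`       : `∑_{n ≤ N} ∏_{h ∈ H} Λ(n+h) = 𝔖(H)·N + o(N)`;
* `Level(H)`    : relative tuple Elliott–Halberstam for the FIXED tuple `H`, level `N^{1-δ}`, every `δ`;
* `Atoms(H,h)`  : `∑_{q ≤ N^{ε₀}} max_{w,y} |∑_{n ≤ y, n ≡ w (q)} λ(n+h) ∏_{h'∈H} Λ(n+h')| ≤ C N/(log N)^A`;
* `Reach`       : `∀ t ≥ 2, Hb, L, ε`: eventually in `N`, for every non-degenerate `Ψ : Fin t → AffLinForm 1` with unit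
  slopes, `‖Ψ‖_N ≤ L`, `|bᵢ - bⱼ| ≤ Hb`, and every convex `K ⊆ [-N,N]`: `|∑_{n∈K} ∏Λ(ψᵢ(n)) - β_∞ ∏_p β_p| ≤ ε N`.
-/

namespace Summit.Parity.GeneralizedHardyLittlewood.Cruxes.EngineToGHL.TupleLadder

open Summit.Parity.GeneralizedHardyLittlewood.Theses
open Summit.Parity.GeneralizedHardyLittlewood.Theses.LiouvilleMAD
open Summit.Parity.GeneralizedHardyLittlewood.Theorems
open Finset Literature.NumberTheory.Sieve
open scoped ArithmeticFunction.vonMangoldt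
open Summit.Parity.GeneralizedHardyLittlewood.Cruxes.PrimeCellsRelative.Sketch (isNondegenerateSystem_shift)

/-! ### Cycle 2: the reach of the tuples conjecture inside `DimOne` (all four pieces landed; re-exported) -/

/-- **reachDictionary — LANDED p140062 as `Theorems.EngineToGHL.TupleLadder.stub_reachDictionary` (theorem-grade, M).** The Green–Tao data of a unit-slope system `ψᵢ(n) = n + bᵢ` with
distinct shifts, `c = min bᵢ`: the weighted prime-point sum over `K ⊆ [-N,N]` (a section `J` of `K`) is the block sum
`∑_{m ∈ [-N,N] ∩ J, m > -c} ∏_{h ∈ H} Λ((m+c) + h)` with `H = {bᵢ - c} ⊆ ℕ` (for `m ≤ -c` the factor with `bᵢ = c`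
is `Λ(≤ 0) = 0`; `∏ᵢ` becomes `∏_{h ∈ H}` by injectivity), and `β_∞ = vol(J ∩ (-c, ∞))` (`∀ i, x + bᵢ > 0 ↔ x > -c`).
Templates: c1's `EngineToGHL.vonMangoldtSum_unitSlopePair`, `archFactor_unitSlopePair`, `eval_unitSlope`,
`sum_filter_piFinset_const_fin_one` (Theorems/LiouvilleMADEngineToGHLPairsReachTools.lean). [folklore] -/
theorem reachDictionary :
    ∀ (t : ℕ) (Ψ : Fin t → Literature.NumberTheory.Sieve.AffLinForm 1), (∀ i j, (Ψ i).coeff j = 1) → Function.Injective (fun i => (Ψ i).const) → ∀ c : ℤ, (∀ i, c ≤ (Ψ i).const) → (∃ i, (Ψ i).const = c) → ∀ (K : Set (Fin 1 → ℝ)) (J : Set ℝ), (∀ y : ℝ, y ∈ J ↔ (fun _ : Fin 1 => y) ∈ K) → ∀ (N : ℕ) (T : Finset ℤ), (∀ m : ℤ, m ∈ T ↔ (m ∈ Finset.Icc (-(N : ℤ)) N ∧ (m : ℝ) ∈ J ∧ -c < m)) → Literature.NumberTheory.Sieve.vonMangoldtSum Ψ K N = (∑ m ∈ T, ∏ h ∈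 Finset.univ.image (fun i => ((Ψ i).const - c).toNat), ArithmeticFunction.vonMangoldt ((m + c).toNat + h)) ∧ Literature.NumberTheory.Sieve.archFactor Ψ K = (MeasureTheory.volume (J ∩ Set.Ioi (-(c : ℝ)))).toReal :=
  Summit.Parity.GeneralizedHardyLittlewood.Theorems.EngineToGHL.TupleLadder.stub_reachDictionary

/-- **reachSingular — LANDED p140069 as `Theorems.EngineToGHL.TupleLadder.stub_reachSingular` (theorem-grade, S/M).** For a unit-slope system with distinct shifts `bᵢ`, Green–Tao's
singular product `∏_p β_p` is the Hardy–Littlewood singular series of the shift set, and of any translate of it: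
`β_p = p⁻¹ (p/(p-1))^t #{n mod p : p ∤ ∏(n+bᵢ)} = (1 - ν(p)/p)(1-1/p)^{-t}` (tree:
`Cruxes.PrimeCellsRelative.Sketch.localFactor_shift_eq_singularSeriesFactor`, `singularProduct_shift_eq_singularSeries`,
`LeeYangFibresCells.goodCount_shift_add`; the system IS the shift system of `b` by `AffLinForm.ext`), and `ν`, `#` are
translation invariant. [folklore] -/
theorem reachSingular :
    ∀ (t : ℕ) (Ψ : Fin t → Literature.NumberTheory.Sieve.AffLinForm 1), (∀ i j, (Ψ i).coeff j = 1) → Function.Injective (fun i => (Ψ i).const) → ∀ c : ℤ, Literature.NumberTheory.Sieve.singularProduct Ψ = Literature.NumberTheory.Sieve.singularSeries (Finset.univ.image (fun i => (Ψ i).const - c)) :=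
  Summit.Parity.GeneralizedHardyLittlewood.Theorems.EngineToGHL.TupleLadder.stub_reachSingular

/-- **hlTuplesUniform — LANDED p140011 as `Theorems.EngineToGHL.TupleLadder.stub_hlTuplesUniform` (theorem-grade, S).** The `o(M)` of Hardy–Littlewood made uniform over the finitely many
tuples `H ∋ 0`, `#H ≥ 2`, `H ⊆ [0, Hb]`: `|S_H(M) - 𝔖(H) M| ≤ δ M + C` for all `M` (template: c1's
`EngineToGHL.pairsHL_uniform_bound`, `abs_sub_le_linear_of_isLittleO`; finitely many `H` = subsets of `range (Hb+1)`,
take the max of the constants). [folklore] -/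
theorem hlTuplesUniform :
    (∀ H : Finset ℕ, 0 ∈ H → 2 ≤ H.card → ((fun N : ℕ => ∑ n ∈ Finset.Icc 1 N, ∏ h ∈ H, ArithmeticFunction.vonMangoldt (n + h) - Literature.NumberTheory.Sieve.singularSeries ((H).image (fun h : ℕ => (h : ℤ))) * N) =o[Filter.atTop] fun N : ℕ => (N : ℝ))) → (∀ (Hb : ℕ) (δ : ℝ), 0 < δ → ∃ C : ℝ, 0 ≤ C ∧ ∀ H : Finset ℕ, 0 ∈ H → 2 ≤ H.card → (∀ h ∈ H, h ≤ Hb) → ∀ M : ℕ, |∑ n ∈ Finset.Icc 1 M, ∏ h ∈ H, ArithmeticFunction.vonMangoldt (n + h) - Literature.NumberTheory.Sieve.singularSeries ((H).image (fun h : ℕ => (h : ℤ))) * M| ≤ δ * M + C) :=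
  Summit.Parity.GeneralizedHardyLittlewood.Theorems.EngineToGHL.TupleLadder.stub_hlTuplesUniform

/-- **tuplesReach — LANDED p140223 as `Theorems.EngineToGHL.TupleLadder.stub_tuplesReach` (theorem-grade, M).** Assembly of the reach from the dictionary, the singular-product identity
and the uniform Hardy–Littlewood bound: for a non-degenerate unit-slope `Ψ : Fin t → AffLinForm 1` (`t ≥ 2`) with
`‖Ψ‖_N ≤ L` and `|bᵢ - bⱼ| ≤ Hb`, put `c = min bᵢ` (`|c| ≤ L N`), `H = {bᵢ - c} ∋ 0` (`#H = t`, `H ⊆ [0,Hb]`); the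
section `J' = J ∩ (-c,∞)` of `K` is an interval in `[-N,N]`, its integer points a block `p..q` (or empty), the block
sum is `S_H(q+c) - S_H(p+c-1)` with both ends `≤ (L+1)N`, the number of integer points is within `1` of `vol(J')`,
and `∏_p β_p = 𝔖(H)` — exactly c1's `pairsReach_of_pairsHL` (Theorems/LiouvilleMADEngineToGHLPairsReach.lean) with
`∏_{h∈H}` in place of the pair product (reuse `abs_card_filter_sub_volume_le_one`, `filter_Icc_mem_eq_Icc`,
`abs_const_le_of_affLinSize_le`, `block_arith`, `ordConnected_section`, `section_subset_Icc`). [folklore] -/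
theorem tuplesReach :
    ∀ (t Hb L : ℕ) (ε : ℝ), 2 ≤ t → 0 < ε → (∀ (t : ℕ) (Ψ : Fin t → Literature.NumberTheory.Sieve.AffLinForm 1), (∀ i j, (Ψ i).coeff j = 1) → Function.Injective (fun i => (Ψ i).const) → ∀ c : ℤ, (∀ i, c ≤ (Ψ i).const) → (∃ i, (Ψ i).const = c) → ∀ (K : Set (Fin 1 → ℝ)) (J : Set ℝ), (∀ y : ℝ, y ∈ J ↔ (fun _ : Fin 1 => y) ∈ K) → ∀ (N : ℕ) (T : Finset ℤ), (∀ m : ℤ, m ∈ T ↔ (m ∈ Finset.Icc (-(N : ℤ)) N ∧ (m : ℝ) ∈ J ∧ -c < m)) → Literature.NumberTheory.Sieve.vonMangoldtSum Ψ K N = (∑ m ∈ T, ∏ h ∈ Finset.univ.image (fun i => ((Ψ i).const - c).toNat), ArithmeticFunction.vonMangoldt ((m + c).toNat + h)) ∧ Literature.NumberTheory.Sieve.archFactor Ψ K = (MeasureTheory.volume (J ∩ Set.Ioi (-(c : ℝ)))).toReal) → (∀ (t : ℕ) (Ψ : Fin t → Literature.NumberTheory.Sieve.AffLinForm 1), (∀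 i j, (Ψ i).coeff j = 1) → Function.Injective (fun i => (Ψ i).const) → ∀ c : ℤ, Literature.NumberTheory.Sieve.singularProduct Ψ = Literature.NumberTheory.Sieve.singularSeries (Finset.univ.image (fun i => (Ψ i).const - c))) → (∀ (Hb : ℕ) (δ : ℝ), 0 < δ → ∃ C : ℝ, 0 ≤ C ∧ ∀ H : Finset ℕ, 0 ∈ H → 2 ≤ H.card → (∀ h ∈ H, h ≤ Hb) → ∀ M : ℕ, |∑ n ∈ Finset.Icc 1 M, ∏ h ∈ H, ArithmeticFunction.vonMangoldt (n + h) - Literature.NumberTheory.Sieve.singularSeries ((H).image (fun h : ℕ => (h : ℤ))) * M| ≤ δ * M + C) → ∃ N₀ : ℕ, ∀ N : ℕ, N₀ ≤ N → ∀ Ψ : Fin t → Literature.NumberTheory.Sieve.AffLinForm 1, Literature.NumberTheory.Sieve.IsNondegenerateSystem Ψ → Literature.NumberTheory.Sieve.affLinSize Ψ N ≤ L → (∀ i j, (Ψ i).coeff j = 1) → (∀ i j, |(Ψ i).const - (Ψ j).const| ≤ (Hb : ℤ)) → ∀ K : Set (Fin 1 → ℝ), Convex ℝ K → K ⊆ Literature.NumberTheory.Sieve.realBox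 1 N → |Literature.NumberTheory.Sieve.vonMangoldtSum Ψ K N - Literature.NumberTheory.Sieve.archFactor Ψ K * Literature.NumberTheory.Sieve.singularProduct Ψ| ≤ ε * (N : ℝ) :=
  Summit.Parity.GeneralizedHardyLittlewood.Theorems.EngineToGHL.TupleLadder.stub_tuplesReach

/-! ### Cycle 3: the residual without its `t = 1` layer, and the inputs aligned with the sloped ladder -/

/-- **stub_reachToDimOneTwo — the RESIDUAL (GHL-hard; NOT a proof target; strictly weaker than the crux,
`reachToDimOneTwo_of_engineToGHL`).** From the reach of the tuples conjecture (all `t ≥ 2`, unit slopes, bounded shift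
differences, all intervals, shifts up to `L N`) to `DimOne` (stmt-Parity-0819) for `t ≥ 2` forms.  v5's `stub_reachToDimOne`
minus its `t = 1` layer, which is a THEOREM (`Cruxes.PrimeCellsRelative.Sketch.stub_dimOne_one`; reassembled in
`reachToDimOne_of_pieces`).  Content exactly: (ii) non-unit SLOPES `aᵢ n + bᵢ` (inside the sibling's rung `stub_slopedRung`
on crux 9389 — not re-registered here); (iii) SHIFT-UNIFORMITY — differences up to `2 L N` (Goldbach, pairs `(n, n+h)` with
`h ≤ L N`): Landau–Siegel-complete (`Negative.tuplesToGHL_false_of_unboundedSiegelZeros`); it implies the sibling's residual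
`stub_shiftLift : BoundedDickson → DimOne` as soon as `BoundedDickson → Reach` (translation) is recorded.
Sources: GreenTao2010, MatomakiMerikoski2023, Dickson1904. [conjecture] -/
theorem stub_reachToDimOneTwo :
    (∀ (t Hb L : ℕ) (ε : ℝ), 2 ≤ t → 0 < ε → ∃ N₀ : ℕ, ∀ N : ℕ, N₀ ≤ N → ∀ Ψ : Fin t → Literature.NumberTheory.Sieve.AffLinForm 1, Literature.NumberTheory.Sieve.IsNondegenerateSystem Ψ → Literature.NumberTheory.Sieve.affLinSize Ψ N ≤ L → (∀ i j, (Ψ i).coeff j = 1) → (∀ i j, |(Ψ i).const - (Ψ j).const| ≤ (Hb : ℤ)) → ∀ K : Set (Fin 1 → ℝ), Convex ℝ K → K ⊆ Literature.NumberTheory.Sieve.realBox 1 N → |Literature.NumberTheory.Sieve.vonMangoldtSum Ψ K N - Literature.NumberTheory.Sieve.archFactor Ψ K * Literature.NumberTheory.Sieve.singularProduct Ψ| ≤ ε * (N : ℝ)) → ∀ (t L : ℕ), 2 ≤ t → ∀ ε : ℝ, 0 < ε → ∃ N₀ : ℕ, ∀ N : ℕ, N₀ ≤ N → ∀ Ψ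 : Fin t → Literature.NumberTheory.Sieve.AffLinForm 1, Literature.NumberTheory.Sieve.IsNondegenerateSystem Ψ → Literature.NumberTheory.Sieve.affLinSize Ψ N ≤ L → ∀ K : Set (Fin 1 → ℝ), Convex ℝ K → K ⊆ Literature.NumberTheory.Sieve.realBox 1 N → |Literature.NumberTheory.Sieve.vonMangoldtSum Ψ K N - Literature.NumberTheory.Sieve.archFactor Ψ K * Literature.NumberTheory.Sieve.singularProduct Ψ| ≤ ε * (N : ℝ) := by
  sorry

/-- The `t = 1` layer of `DimOne` is a tree THEOREM: one form `a n + b` has finite complexity, Green–Tao Thm. 4.5 at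
level `s = 1` (`GreenTao2010_mainNormalFormAt_one`, proved) and the §4 reduction give it
(`Cruxes.PrimeCellsRelative.Sketch.stub_dimOne_one`, file `Theorems/LeeYangFibresPrimeCellsRelativeDimOneOne.lean`).
[cite: GreenTao2010, Main Theorem at `t = 1`] -/
theorem dimOne_one : ∀ L : ℕ, ∀ ε : ℝ, 0 < ε → ∃ N₀ : ℕ, ∀ N : ℕ, N₀ ≤ N → ∀ Ψ : Fin 1 → Literature.NumberTheory.Sieve.AffLinForm 1, Literature.NumberTheory.Sieve.IsNondegenerateSystem Ψ → Literature.NumberTheory.Sieve.affLinSize Ψ N ≤ L → ∀ K : Set (Fin 1 → ℝ), Convex ℝ K → K ⊆ Literature.NumberTheory.Sieve.realBox 1 N → |Literature.NumberTheory.Sieve.vonMangoldtSum Ψ K N - Literature.NumberTheory.Sieve.archFactor Ψ K * Literature.NumberTheory.Sieve.singularProduct Ψ| ≤ ε * (N : ℝ) :=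
  Summit.Parity.GeneralizedHardyLittlewood.Cruxes.PrimeCellsRelative.Sketch.stub_dimOne_one

/-- v5's residual `Reach → DimOne` (registered text of the former `stub_reachToDimOne`), reassembled from the theorem
`dimOne_one` (`t = 1`) and the new residual `stub_reachToDimOneTwo` (`t ≥ 2`). [folklore] -/
theorem reachToDimOne_of_pieces (h1 : ∀ L : ℕ, ∀ ε : ℝ, 0 < ε → ∃ N₀ : ℕ, ∀ N : ℕ, N₀ ≤ N → ∀ Ψ : Fin 1 → Literature.NumberTheory.Sieve.AffLinForm 1, Literature.NumberTheory.Sieve.IsNondegenerateSystem Ψ → Literature.NumberTheory.Sieve.affLinSize Ψ N ≤ L → ∀ K : Set (Fin 1 → ℝ), Convex ℝ K → K ⊆ Literature.NumberTheory.Sieve.realBox 1 N → |Literature.NumberTheory.Sieve.vonMangoldtSum Ψ K N - Literature.NumberTheory.Sieve.archFactor Ψ K * Literature.NumberTheory.Sieve.singularProduct Ψ| ≤ ε * (N : ℝ))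
    (h2 : (∀ (t Hb L : ℕ) (ε : ℝ), 2 ≤ t → 0 < ε → ∃ N₀ : ℕ, ∀ N : ℕ, N₀ ≤ N → ∀ Ψ : Fin t → Literature.NumberTheory.Sieve.AffLinForm 1, Literature.NumberTheory.Sieve.IsNondegenerateSystem Ψ → Literature.NumberTheory.Sieve.affLinSize Ψ N ≤ L → (∀ i j, (Ψ i).coeff j = 1) → (∀ i j, |(Ψ i).const - (Ψ j).const| ≤ (Hb : ℤ)) → ∀ K : Set (Fin 1 → ℝ), Convex ℝ K → K ⊆ Literature.NumberTheory.Sieve.realBox 1 N → |Literature.NumberTheory.Sieve.vonMangoldtSum Ψ K N - Literature.NumberTheory.Sieve.archFactor Ψ K * Literature.NumberTheory.Sieve.singularProduct Ψ| ≤ ε * (N : ℝ)) → ∀ (t L : ℕ), 2 ≤ t → ∀ ε : ℝ, 0 < ε → ∃ N₀ : ℕ, ∀ N : ℕ, N₀ ≤ N → ∀ Ψ : Fin t → Literature.NumberTheory.Sieve.AffLinForm 1, Literature.NumberTheory.Sieve.IsNondegenerateSystem Ψ → Literature.NumberTheory.Sieve.affLinSize Ψ N ≤ L → ∀ K : Set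 (Fin 1 → ℝ), Convex ℝ K → K ⊆ Literature.NumberTheory.Sieve.realBox 1 N → |Literature.NumberTheory.Sieve.vonMangoldtSum Ψ K N - Literature.NumberTheory.Sieve.archFactor Ψ K * Literature.NumberTheory.Sieve.singularProduct Ψ| ≤ ε * (N : ℝ)) :
    (∀ (t Hb L : ℕ) (ε : ℝ), 2 ≤ t → 0 < ε → ∃ N₀ : ℕ, ∀ N : ℕ, N₀ ≤ N → ∀ Ψ : Fin t → Literature.NumberTheory.Sieve.AffLinForm 1, Literature.NumberTheory.Sieve.IsNondegenerateSystem Ψ → Literature.NumberTheory.Sieve.affLinSize Ψ N ≤ L → (∀ i j, (Ψ i).coeff j = 1) → (∀ i j, |(Ψ i).const - (Ψ j).const| ≤ (Hb : ℤ)) → ∀ K : Set (Fin 1 → ℝ), Convex ℝ K → K ⊆ Literature.NumberTheory.Sieve.realBox 1 N → |Literature.NumberTheory.Sieve.vonMangoldtSum Ψ K N - Literature.NumberTheory.Sieve.archFactor Ψ K * Literature.NumberTheory.Sieve.singularProduct Ψ| ≤ ε * (N : ℝ)) → ∀ (t L : ℕ), 1 ≤ t → ∀ ε : ℝ, 0 <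 ε → ∃ N₀ : ℕ, ∀ N : ℕ, N₀ ≤ N → ∀ Ψ : Fin t → Literature.NumberTheory.Sieve.AffLinForm 1, Literature.NumberTheory.Sieve.IsNondegenerateSystem Ψ → Literature.NumberTheory.Sieve.affLinSize Ψ N ≤ L → ∀ K : Set (Fin 1 → ℝ), Convex ℝ K → K ⊆ Literature.NumberTheory.Sieve.realBox 1 N → |Literature.NumberTheory.Sieve.vonMangoldtSum Ψ K N - Literature.NumberTheory.Sieve.archFactor Ψ K * Literature.NumberTheory.Sieve.singularProduct Ψ| ≤ ε * (N : ℝ) := by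
  intro hR t L ht ε hε
  rcases Nat.lt_or_ge t 2 with ht1 | ht2
  · obtain rfl : t = 1 := by omega
    exact h1 L ε hε
  · exact h2 hR t L ht2 ε hε

/-- **stub_slopedLevelInput — conjecture-grade INPUT, VERBATIM the sibling's `stub_slopedLevel` (crux 9389, line
`sloped_ladder`); NOT a proof target.** Relative Elliott–Halberstam for the weight `F_Φ(n) = ∏ᵢ Λ(aᵢ n + bᵢ)` of every
fixed positive non-degenerate one-dimensional system, level `N^{1-δ}` (every `δ`), admissible classes equiprobable.
Its unit-slope instances are v5's `stub_tupleLevel` (`tupleLevelOfSloped`); `t = 1` is Elliott–Halberstam for primes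
in progressions (the route's declared bridge `ElliottHalberstam`).  Siegel-inert (fixed systems).
Sources: ElliottHalberstam1970, FriedlanderGranville1989, BombieriAsymptoticSieve1976. [conjecture] -/
theorem stub_slopedLevelInput :
    ∀ t : ℕ, 1 ≤ t → ∀ Φ : Fin t → Literature.NumberTheory.Sieve.AffLinForm 1, Literature.NumberTheory.Sieve.IsNondegenerateSystem Φ → (∀ i, 0 < (Φ i).coeff 0 ∧ 0 ≤ (Φ i).const) → (∀ δ : ℝ, 0 < δ → ∀ B : ℝ, ∃ C : ℝ, ∀ N : ℕ, 2 ≤ N → ∀ y r : ℕ → ℕ, (∀ d, y d ≤ N) → (∑ d ∈ Finset.Icc 1 ⌊(N : ℝ) ^ (1 - δ)⌋₊, |(∑ n ∈ (Finset.Icc 1 (y d)).filter (fun n : ℕ => n ≡ r d [MOD d]), ∏ i, Literature.NumberTheory.Sieve.intVonMangoldt ((Φ i).eval ![(n : ℤ)])) - (if ∀ i, Int.gcd ((Φ i).eval ![(r d : ℤ)]) d = 1 then ((((Finset.range d).filter (fun ρ : ℕ => ∀ i, Int.gcd ((Φ i).eval ![(ρ : ℤ)]) d = 1)).card : ℝ))⁻¹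 else 0) * ∑ n ∈ Finset.Icc 1 (y d), ∏ i, Literature.NumberTheory.Sieve.intVonMangoldt ((Φ i).eval ![(n : ℤ)])|) ≤ C * N / Real.log N ^ B) := by
  sorry

/-- **stub_slopedAtomsInput — conjecture-grade PARITY INPUT, VERBATIM the sibling's `stub_slopedAtoms` (crux 9389);
NOT a proof target.** One Liouville factor on the adjoined form `ψ` against the tuple weight `F_Φ`, moduli `q ≤ N^{ε₀}`,
one class and one height per modulus; the extended system `vecCons ψ Φ` non-degenerate (load-bearing).  Its unit-slope
instances are v5's `stub_tupleAtoms` (`tupleAtomsOfSloped`); `Φ = (n)`, `ψ = n + h` is the route node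
`LambdaLiouvilleLevel`/`MAvg` in `Λ·λ` clothing.  Parity-sensitive; Siegel-inert.
Sources: LichtmanTeravainen2022, TaoTeravainen2021, MurtyVatwani2017. [conjecture] -/
theorem stub_slopedAtomsInput :
    ∀ t : ℕ, 1 ≤ t → ∀ (Φ : Fin t → Literature.NumberTheory.Sieve.AffLinForm 1) (ψ : Literature.NumberTheory.Sieve.AffLinForm 1), Literature.NumberTheory.Sieve.IsNondegenerateSystem (Matrix.vecCons ψ Φ) → (∀ i, 0 < (Φ i).coeff 0 ∧ 0 ≤ (Φ i).const) → (0 < ψ.coeff 0 ∧ 0 ≤ ψ.const) → (∃ ε₀ : ℝ, 0 < ε₀ ∧ ∀ A : ℝ, 0 < A → ∃ C : ℝ, ∃ N₀ : ℕ, ∀ N : ℕ, N₀ ≤ N → ∀ w y : ℕ → ℕ, (∀ q, y q ≤ N) → (∑ q ∈ Finset.Icc 1 ⌊(N : ℝ) ^ ε₀⌋₊, |∑ n ∈ (Finset.Icc 1 (y q)).filter (fun n : ℕ => n ≡ w q [MOD q]), (ArithmeticFunction.liouville (Int.toNat (ψ.eval ![(n : ℤ)])) : ℝ) * ∏ i,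 Literature.NumberTheory.Sieve.intVonMangoldt ((Φ i).eval ![(n : ℤ)])|) ≤ C * N / Real.log N ^ A) := by
  sorry

/-! ### Transfer from the sloped inputs (INLINED copy of the landed `Theorems/LiouvilleMADEngineToGHLSlopedInputs.lean`, p141122,
namespace `…Theorems.EngineToGHL.SlopedInputs`; inlined only so that this workfile elaborates before the farm has built that module —
switch to the import at the next reshape) -/

/-- `ψ(n) = n + c` for the unit-slope form with constant `c`, at the point `![n]`. [folklore] -/
theorem eval_shiftForm (c n : ℤ) : (⟨fun _ => (1 : ℤ), c⟩ : AffLinForm 1).eval ![n] = n + c := by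
  rw [DimOne.eval_eq]
  simp

/-- `Λ_ℤ(n + m) = Λ(n + m)` for natural `n, m`. [folklore] -/
theorem intVonMangoldt_natCast_add (n m : ℕ) : intVonMangoldt ((n : ℤ) + (m : ℤ)) = Λ (n + m) := by
  unfold intVonMangoldt
  rw [← Nat.cast_add, Int.toNat_natCast]

/-- `(n + m).toNat = n + m` for natural `n, m`. [folklore] -/
theorem toNat_natCast_add (n m : ℕ) : Int.toNat ((n : ℤ) + (m : ℤ)) = n + m := by
  rw [← Nat.cast_add, Int.toNat_natCast]

/-- `gcd_ℤ(ρ + m, d) = 1 ↔ ρ + m ⊥ d` for natural `ρ, m, d`. [folklore] -/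
theorem int_gcd_natCast_add_eq_one_iff (ρ m d : ℕ) :
    Int.gcd ((ρ : ℤ) + (m : ℤ)) d = 1 ↔ Nat.Coprime (ρ + m) d := by
  rw [← Nat.cast_add, Int.gcd_natCast_natCast, Nat.coprime_iff_gcd_eq_one]

/-- `∏ⱼ Λ(n + hⱼ) = ∏_{h ∈ H} Λ(n + h)` for the enumeration `hⱼ = H.equivFin⁻¹ j`. [folklore] -/
theorem prod_vonMangoldt_equivFin_symm (H : Finset ℕ) (n : ℕ) :
    ∏ j : Fin H.card, Λ (n + (H.equivFin.symm j : ℕ)) = ∏ h ∈ H, Λ (n + h) := by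
  rw [← Finset.prod_coe_sort H (fun h => Λ (n + h))]
  exact Fintype.prod_equiv H.equivFin.symm _ _ (fun _ => rfl)

/-- `(ρ + hⱼ ⊥ d ∀ j) ↔ (ρ + h ⊥ d ∀ h ∈ H)` for the enumeration `hⱼ = H.equivFin⁻¹ j`. [folklore] -/
theorem forall_coprime_equivFin_symm (H : Finset ℕ) (ρ d : ℕ) :
    (∀ j : Fin H.card, Nat.Coprime (ρ + (H.equivFin.symm j : ℕ)) d) ↔ ∀ h ∈ H, Nat.Coprime (ρ + h) d := by
  constructor
  · intro hj h hh
    simpa using hj (H.equivFin ⟨h, hh⟩)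
  · intro hh j
    exact hh _ (H.equivFin.symm j).2

/-- The enumeration `j ↦ (hⱼ : ℤ)` of `H ⊆ ℕ` is injective. [folklore] -/
theorem injective_equivFin_symm_cast (H : Finset ℕ) :
    Function.Injective (fun j : Fin H.card => ((H.equivFin.symm j : ℕ) : ℤ)) := by
  intro i j hij
  have h0 : ((H.equivFin.symm i : ℕ) : ℤ) = ((H.equivFin.symm j : ℕ) : ℤ) := hij
  have h : (H.equivFin.symm i : ℕ) = (H.equivFin.symm j : ℕ) := by exact_mod_cast h0
  exact H.equivFin.symm.injective (Subtype.ext h)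

/-- The translate system of `H` is non-degenerate (distinct shifts). [cite: GreenTao2010, Def. 1.1] -/
theorem isNondegenerateSystem_translate (H : Finset ℕ) :
    IsNondegenerateSystem
      (fun j : Fin H.card => (⟨fun _ => (1 : ℤ), ((H.equivFin.symm j : ℕ) : ℤ)⟩ : AffLinForm 1)) :=
  isNondegenerateSystem_shift _ (injective_equivFin_symm_cast H)

/-- Adjoining `ψ(n) = n + h` with `h ∉ H` to the translate system of `H` gives the translate system of the
tuple `(h, h₀, …)`, again with distinct shifts, hence non-degenerate. [cite: GreenTao2010, Def. 1.1] -/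
theorem isNondegenerateSystem_vecCons_translate (H : Finset ℕ) (h : ℕ) (hh : h ∉ H) :
    IsNondegenerateSystem (Matrix.vecCons (⟨fun _ => (1 : ℤ), (h : ℤ)⟩ : AffLinForm 1)
      (fun j : Fin H.card => (⟨fun _ => (1 : ℤ), ((H.equivFin.symm j : ℕ) : ℤ)⟩ : AffLinForm 1))) := by
  have hcons : Matrix.vecCons (⟨fun _ => (1 : ℤ), (h : ℤ)⟩ : AffLinForm 1)
      (fun j : Fin H.card => (⟨fun _ => (1 : ℤ), ((H.equivFin.symm j : ℕ) : ℤ)⟩ : AffLinForm 1)) =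
      fun j => (⟨fun _ => (1 : ℤ),
        (Fin.cons (h : ℤ) (fun j : Fin H.card => ((H.equivFin.symm j : ℕ) : ℤ)) : Fin (H.card + 1) → ℤ) j⟩ :
          AffLinForm 1) := by
    funext j
    refine Fin.cases ?_ (fun i => ?_) j
    · simp
    · simp
  rw [hcons]
  refine isNondegenerateSystem_shift _ (Fin.cons_injective_iff.mpr ⟨?_, injective_equivFin_symm_cast H⟩)
  rintro ⟨j, hj⟩
  have hj0 : ((H.equivFin.symm j : ℕ) : ℤ) = (h : ℤ) := hj
  have hj' : (H.equivFin.symm j : ℕ) = h := by exact_mod_cast hj0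
  exact hh (hj' ▸ (H.equivFin.symm j).2)

/-! ### The sloped inputs subsume the unit-slope inputs -/

/-- **`stub_slopedLevel` (crux 9389, line `sloped_ladder`) implies `stub_tupleLevel` (crux 14995, line
`tuple_ladder`), statements verbatim.** Instantiate the sloped relative level-of-distribution hypothesis at the
translate system `ψⱼ(n) = n + hⱼ` of `H` (`t = #H ≥ 2`, slopes `1`, shifts `hⱼ ≥ 0`, non-degenerate) and
translate the weight `∏ⱼ Λ_ℤ(ψⱼ(n)) = ∏_{h∈H} Λ(n+h)` and the admissible-class condition
`gcd(ρ + hⱼ, d) = 1 ∀ j ↔ ρ + h ⊥ d ∀ h ∈ H`. [folklore] -/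
theorem tupleLevelOfSloped :
    (∀ t : ℕ, 1 ≤ t → ∀ Φ : Fin t → Literature.NumberTheory.Sieve.AffLinForm 1, Literature.NumberTheory.Sieve.IsNondegenerateSystem Φ → (∀ i, 0 < (Φ i).coeff 0 ∧ 0 ≤ (Φ i).const) → (∀ δ : ℝ, 0 < δ → ∀ B : ℝ, ∃ C : ℝ, ∀ N : ℕ, 2 ≤ N → ∀ y r : ℕ → ℕ, (∀ d, y d ≤ N) → (∑ d ∈ Finset.Icc 1 ⌊(N : ℝ) ^ (1 - δ)⌋₊, |(∑ n ∈ (Finset.Icc 1 (y d)).filter (fun n : ℕ => n ≡ r d [MOD d]), ∏ i, Literature.NumberTheory.Sieve.intVonMangoldt ((Φ i).eval ![(n : ℤ)])) - (if ∀ i, Int.gcd ((Φ i).eval ![(r d : ℤ)]) d = 1 then ((((Finset.range d).filter (fun ρ : ℕ => ∀ i, Int.gcd ((Φ i).eval ![(ρ : ℤ)]) d = 1)).card : ℝ))⁻¹ else 0) * ∑ n ∈ Finset.Icc 1 (y d), ∏ i, Literature.NumberTheory.Sieve.intVonMangoldt ((Φ i).eval ![(n : ℤ)])|) ≤ C * N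 / Real.log N ^ B)) →
    ∀ H : Finset ℕ, 0 ∈ H → 2 ≤ H.card → (∀ δ : ℝ, 0 < δ → ∀ B : ℝ, ∃ C : ℝ, ∀ N : ℕ, 2 ≤ N → ∀ y r : ℕ → ℕ, (∀ d, y d ≤ N) → (∑ d ∈ Finset.Icc 1 ⌊(N : ℝ) ^ (1 - δ)⌋₊, |(∑ n ∈ (Finset.Icc 1 (y d)).filter (fun n : ℕ => n ≡ r d [MOD d]), ∏ h ∈ H, ArithmeticFunction.vonMangoldt (n + h)) - (if ∀ h ∈ H, Nat.Coprime (r d + h) d then (((Finset.range d).filter (fun ρ : ℕ => ∀ h ∈ H, Nat.Coprime (ρ + h) d)).card : ℝ)⁻¹ else 0) * ∑ n ∈ Finset.Icc 1 (y d), ∏ h ∈ H, ArithmeticFunction.vonMangoldt (n + h)|) ≤ C * N / Real.log N ^ B) := by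
  intro hS H _h0 hH δ hδ B
  have hk : 1 ≤ H.card := by omega
  have hpos : ∀ i : Fin H.card,
      0 < ((fun j : Fin H.card => (⟨fun _ => (1 : ℤ), ((H.equivFin.symm j : ℕ) : ℤ)⟩ : AffLinForm 1)) i).coeff 0 ∧
        0 ≤ ((fun j : Fin H.card => (⟨fun _ => (1 : ℤ), ((H.equivFin.symm j : ℕ) : ℤ)⟩ : AffLinForm 1)) i).const :=
    fun i => ⟨one_pos, Int.natCast_nonneg _⟩
  obtain ⟨C, hC⟩ := hS H.card hk _ (isNondegenerateSystem_translate H) hpos δ hδ B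
  refine ⟨C, fun N hN y r hy => ?_⟩
  have h := hC N hN y r hy
  simp only [eval_shiftForm, intVonMangoldt_natCast_add, int_gcd_natCast_add_eq_one_iff,
    prod_vonMangoldt_equivFin_symm, forall_coprime_equivFin_symm] at h
  exact h

/-- **`stub_slopedAtoms` (crux 9389) implies `stub_tupleAtoms` (crux 14995), statements verbatim.** Instantiate
at the translate system of `H` with the adjoined form `ψ(n) = n + h` (`h ∉ H`: the extended system
`vecCons ψ Φ` is the translate system of distinct shifts, hence non-degenerate); `λ(ψ(n).toNat) = λ(n + h)`.
[folklore] -/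
theorem tupleAtomsOfSloped :
    (∀ t : ℕ, 1 ≤ t → ∀ (Φ : Fin t → Literature.NumberTheory.Sieve.AffLinForm 1) (ψ : Literature.NumberTheory.Sieve.AffLinForm 1), Literature.NumberTheory.Sieve.IsNondegenerateSystem (Matrix.vecCons ψ Φ) → (∀ i, 0 < (Φ i).coeff 0 ∧ 0 ≤ (Φ i).const) → (0 < ψ.coeff 0 ∧ 0 ≤ ψ.const) → (∃ ε₀ : ℝ, 0 < ε₀ ∧ ∀ A : ℝ, 0 < A → ∃ C : ℝ, ∃ N₀ : ℕ, ∀ N : ℕ, N₀ ≤ N → ∀ w y : ℕ → ℕ, (∀ q, y q ≤ N) → (∑ q ∈ Finset.Icc 1 ⌊(N : ℝ) ^ ε₀⌋₊, |∑ n ∈ (Finset.Icc 1 (y q)).filter (fun n : ℕ => n ≡ w q [MOD q]), (ArithmeticFunction.liouville (Int.toNat (ψ.eval ![(n : ℤ)])) : ℝ) * ∏ i, Literature.NumberTheory.Sieve.intVonMangoldt ((Φ i).eval ![(n : ℤ)])|) ≤ C * N / Real.log N ^ A)) →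
    ∀ (H : Finset ℕ) (h : ℕ), 0 ∈ H → 2 ≤ H.card → h ∉ H → (∃ ε₀ : ℝ, 0 < ε₀ ∧ ∀ A : ℝ, 0 < A → ∃ C : ℝ, ∃ N₀ : ℕ, ∀ N : ℕ, N₀ ≤ N → ∀ w y : ℕ → ℕ, (∀ q, y q ≤ N) → (∑ q ∈ Finset.Icc 1 ⌊(N : ℝ) ^ ε₀⌋₊, |∑ n ∈ (Finset.Icc 1 (y q)).filter (fun n : ℕ => n ≡ w q [MOD q]), (ArithmeticFunction.liouville (n + h) : ℝ) * ∏ h' ∈ H, ArithmeticFunction.vonMangoldt (n + h')|) ≤ C * N / Real.log N ^ A) := by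
  intro hS H h _h0 hH hh
  have hk : 1 ≤ H.card := by omega
  have hpos : ∀ i : Fin H.card,
      0 < ((fun j : Fin H.card => (⟨fun _ => (1 : ℤ), ((H.equivFin.symm j : ℕ) : ℤ)⟩ : AffLinForm 1)) i).coeff 0 ∧
        0 ≤ ((fun j : Fin H.card => (⟨fun _ => (1 : ℤ), ((H.equivFin.symm j : ℕ) : ℤ)⟩ : AffLinForm 1)) i).const :=
    fun i => ⟨one_pos, Int.natCast_nonneg _⟩
  have hψ : 0 < (⟨fun _ => (1 : ℤ), (h : ℤ)⟩ : AffLinForm 1).coeff 0 ∧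
      0 ≤ (⟨fun _ => (1 : ℤ), (h : ℤ)⟩ : AffLinForm 1).const :=
    ⟨one_pos, Int.natCast_nonneg _⟩
  obtain ⟨ε₀, hε₀, hA⟩ := hS H.card hk _ _ (isNondegenerateSystem_vecCons_translate H h hh) hpos hψ
  refine ⟨ε₀, hε₀, fun A hA0 => ?_⟩
  obtain ⟨C, N₀, hC⟩ := hA A hA0
  refine ⟨C, N₀, fun N hN w y hy => ?_⟩
  have h1 := hC N hN w y hy
  simp only [eval_shiftForm, intVonMangoldt_natCast_add, toNat_natCast_add,
    prod_vonMangoldt_equivFin_symm] at h1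
  exact h1

/-- v5's unit-slope input `TupleLevel` (registered text of the former `stub_tupleLevel`), now DERIVED. [folklore] -/
theorem tupleLevel : ∀ H : Finset ℕ, 0 ∈ H → 2 ≤ H.card → (∀ δ : ℝ, 0 < δ → ∀ B : ℝ, ∃ C : ℝ, ∀ N : ℕ, 2 ≤ N → ∀ y r : ℕ → ℕ, (∀ d, y d ≤ N) → (∑ d ∈ Finset.Icc 1 ⌊(N : ℝ) ^ (1 - δ)⌋₊, |(∑ n ∈ (Finset.Icc 1 (y d)).filter (fun n : ℕ => n ≡ r d [MOD d]), ∏ h ∈ H, ArithmeticFunction.vonMangoldt (n + h)) - (if ∀ h ∈ H, Nat.Coprime (r d + h) d then (((Finset.range d).filter (fun ρ : ℕ => ∀ h ∈ H, Nat.Coprime (ρ + h) d)).card : ℝ)⁻¹ else 0) * ∑ n ∈ Finset.Icc 1 (y d), ∏ h ∈ H, ArithmeticFunction.vonMangoldt (n + h)|) ≤ C * N / Real.log N ^ B) :=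
  tupleLevelOfSloped stub_slopedLevelInput

/-- v5's unit-slope input `TupleAtoms` (registered text of the former `stub_tupleAtoms`), now DERIVED. [folklore] -/
theorem tupleAtoms : ∀ (H : Finset ℕ) (h : ℕ), 0 ∈ H → 2 ≤ H.card → h ∉ H → (∃ ε₀ : ℝ, 0 < ε₀ ∧ ∀ A : ℝ, 0 < A → ∃ C : ℝ, ∃ N₀ : ℕ, ∀ N : ℕ, N₀ ≤ N → ∀ w y : ℕ → ℕ, (∀ q, y q ≤ N) → (∑ q ∈ Finset.Icc 1 ⌊(N : ℝ) ^ ε₀⌋₊, |∑ n ∈ (Finset.Icc 1 (y q)).filter (fun n : ℕ => n ≡ w q [MOD q]), (ArithmeticFunction.liouville (n + h) : ℝ) * ∏ h' ∈ H, ArithmeticFunction.vonMangoldt (n + h')|) ≤ C * N / Real.log N ^ A) :=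
  tupleAtomsOfSloped stub_slopedAtomsInput

/-! ### The rung (cycle 1; all four pieces landed) -/

/-- **The rung** (registered signature of the former `stub_tupleLadder`; LANDED p139876 as
`Theorems.EngineToGHL.TupleLadder.tupleLadder_rung`, from `stub_rungWeights → stub_rungEuler`, `stub_rungLarge`,
`stub_rungAssembly`). [folklore] -/
theorem tupleLadder_rung :
    ∀ t : ℕ, 2 ≤ t → (∀ H : Finset ℕ, 0 ∈ H → H.card = t → ((fun N : ℕ => ∑ n ∈ Finset.Icc 1 N, ∏ h ∈ H, ArithmeticFunction.vonMangoldt (n + h) - Literature.NumberTheory.Sieve.singularSeries ((H).image (fun h : ℕ => (h : ℤ))) * N) =o[Filter.atTop] fun N : ℕ => (N : ℝ))) → (∀ H : Finset ℕ, 0 ∈ H → H.card = t → (∀ δ : ℝ, 0 < δ → ∀ B : ℝ, ∃ C : ℝ, ∀ N : ℕ, 2 ≤ N → ∀ y r : ℕ → ℕ, (∀ d, y d ≤ N) → (∑ d ∈ Finset.Icc 1 ⌊(N : ℝ) ^ (1 - δ)⌋₊, |(∑ n ∈ (Finset.Icc 1 (y d)).filter (fun n : ℕ => n ≡ r d [MOD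 d]), ∏ h ∈ H, ArithmeticFunction.vonMangoldt (n + h)) - (if ∀ h ∈ H, Nat.Coprime (r d + h) d then (((Finset.range d).filter (fun ρ : ℕ => ∀ h ∈ H, Nat.Coprime (ρ + h) d)).card : ℝ)⁻¹ else 0) * ∑ n ∈ Finset.Icc 1 (y d), ∏ h ∈ H, ArithmeticFunction.vonMangoldt (n + h)|) ≤ C * N / Real.log N ^ B)) → (∀ (H : Finset ℕ) (h : ℕ), 0 ∈ H → H.card = t → h ∉ H → (∃ ε₀ : ℝ, 0 < ε₀ ∧ ∀ A : ℝ, 0 < A → ∃ C : ℝ, ∃ N₀ : ℕ, ∀ N : ℕ, N₀ ≤ N → ∀ w y : ℕ → ℕ, (∀ q, y q ≤ N) → (∑ q ∈ Finset.Icc 1 ⌊(N : ℝ) ^ ε₀⌋₊, |∑ n ∈ (Finset.Icc 1 (y q)).filter (fun n : ℕ => n ≡ w q [MOD q]), (ArithmeticFunction.liouville (n + h) : ℝ) * ∏ h' ∈ H, ArithmeticFunction.vonMangoldt (n + h')|) ≤ C * N / Real.log N ^ A)) → ∀ H : Finset ℕ, 0 ∈ H → H.card = t + 1 → ((fun N :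 ℕ => ∑ n ∈ Finset.Icc 1 N, ∏ h ∈ H, ArithmeticFunction.vonMangoldt (n + h) - Literature.NumberTheory.Sieve.singularSeries ((H).image (fun h : ℕ => (h : ℤ))) * N) =o[Filter.atTop] fun N : ℕ => (N : ℝ)) :=
  Summit.Parity.GeneralizedHardyLittlewood.Theorems.EngineToGHL.TupleLadder.tupleLadder_rung

/-! ### Cycle-2 composition (sorry-free): tuples ⇒ reach ⇒ (residual) DimOne -/

/-- **The reach of the tuples conjecture**, from the four cycle-2 pieces. [folklore] -/
theorem tuplesReach_of_hlTuples :
    (∀ H : Finset ℕ, 0 ∈ H → 2 ≤ H.card → ((fun N : ℕ => ∑ n ∈ Finset.Icc 1 N, ∏ h ∈ H, ArithmeticFunction.vonMangoldt (n + h) - Literature.NumberTheory.Sieve.singularSeries ((H).image (fun h : ℕ => (h : ℤ))) * N) =o[Filter.atTop] fun N : ℕ => (N : ℝ))) → (∀ (t Hb L : ℕ) (ε : ℝ), 2 ≤ t → 0 < ε → ∃ N₀ : ℕ, ∀ N : ℕ, N₀ ≤ N → ∀ Ψ : Fin t → Literature.NumberTheory.Sieve.AffLinForm 1, Literature.NumberTheory.Sieve.IsNondegenerateSystem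 Ψ → Literature.NumberTheory.Sieve.affLinSize Ψ N ≤ L → (∀ i j, (Ψ i).coeff j = 1) → (∀ i j, |(Ψ i).const - (Ψ j).const| ≤ (Hb : ℤ)) → ∀ K : Set (Fin 1 → ℝ), Convex ℝ K → K ⊆ Literature.NumberTheory.Sieve.realBox 1 N → |Literature.NumberTheory.Sieve.vonMangoldtSum Ψ K N - Literature.NumberTheory.Sieve.archFactor Ψ K * Literature.NumberTheory.Sieve.singularProduct Ψ| ≤ ε * (N : ℝ)) :=
  fun hT t Hb L ε ht hε => tuplesReach t Hb L ε ht hε reachDictionary reachSingular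
    (hlTuplesUniform hT)

/-- The former residual `Tuples → DimOne`, through the reach and the `t = 1` theorem: its only open part is
`stub_reachToDimOneTwo`. [folklore] -/
theorem tuplesToDimOne_of_pieces :
    (∀ H : Finset ℕ, 0 ∈ H → 2 ≤ H.card → ((fun N : ℕ => ∑ n ∈ Finset.Icc 1 N, ∏ h ∈ H, ArithmeticFunction.vonMangoldt (n + h) - Literature.NumberTheory.Sieve.singularSeries ((H).image (fun h : ℕ => (h : ℤ))) * N) =o[Filter.atTop] fun N : ℕ => (N : ℝ))) → ∀ (t L : ℕ), 1 ≤ t → ∀ ε : ℝ, 0 < ε → ∃ N₀ : ℕ, ∀ N : ℕ, N₀ ≤ N → ∀ Ψ : Fin t → Literature.NumberTheory.Sieve.AffLinForm 1, Literature.NumberTheory.Sieve.IsNondegenerateSystem Ψ → Literature.NumberTheory.Sieve.affLinSize Ψ N ≤ L → ∀ K : Set (Fin 1 → ℝ), Convex ℝ K → K ⊆ Literature.NumberTheory.Sieve.realBox 1 N → |Literature.NumberTheory.Sieve.vonMangoldtSum Ψ K N - Literature.NumberTheory.Sieve.archFactor Ψ K * Literature.NumberTheory.Sieve.singularProduct Ψ|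 ≤ ε * (N : ℝ) :=
  fun hT => reachToDimOne_of_pieces dimOne_one stub_reachToDimOneTwo (tuplesReach_of_hlTuples hT)

/-! ### Composition (sorry-free; the split glue, unchanged) -/

/-- Base of the ladder: `PairsHL` is `HL(H)` for every `2`-set `H ∋ 0`. [folklore] -/
theorem hlTuple_pair_of_pairsHL (hP : LiouvilleShiftedTables.PairsHL) :
    ∀ H : Finset ℕ, 0 ∈ H → H.card = 2 → ((fun N : ℕ => ∑ n ∈ Finset.Icc 1 N, ∏ h ∈ H, ArithmeticFunction.vonMangoldt (n + h) - Literature.NumberTheory.Sieve.singularSeries ((H).image (fun h : ℕ => (h : ℤ))) * N) =o[Filter.atTop] fun N : ℕ => (N : ℝ)) := by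
  have key : ∀ k : ℕ, k ≠ 0 → ((fun N : ℕ => ∑ n ∈ Finset.Icc 1 N, ∏ h ∈ ({0, k} : Finset ℕ), ArithmeticFunction.vonMangoldt (n + h) - Literature.NumberTheory.Sieve.singularSeries ((({0, k} : Finset ℕ)).image (fun h : ℕ => (h : ℤ))) * N) =o[Filter.atTop] fun N : ℕ => (N : ℝ)) := by
    intro k hk
    have hk1 : 1 ≤ k := Nat.one_le_iff_ne_zero.mpr hk
    have h0k : (0 : ℕ) ≠ k := fun h => hk h.symm
    have himg : (({0, k} : Finset ℕ).image (fun h : ℕ => (h : ℤ))) = ({0, (k : ℤ)} : Finset ℤ) := by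
      simp [Finset.image_insert, Finset.image_singleton]
    have hprod : ∀ n : ℕ, ∏ h ∈ ({0, k} : Finset ℕ), ArithmeticFunction.vonMangoldt (n + h) =
        ArithmeticFunction.vonMangoldt n * ArithmeticFunction.vonMangoldt (n + k) := by
      intro n
      rw [Finset.prod_pair h0k, Nat.add_zero]
    simp only [hprod, himg]
    exact hP k hk1
  intro H h0 hcard
  obtain ⟨x, y, hxy, rfl⟩ := Finset.card_eq_two.mp hcard
  rcases Finset.mem_insert.mp h0 with hx | hy
  · subst hx
    exact key y (fun h => hxy h.symm)
  · rw [Finset.mem_singleton] at hy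
    subst hy
    rw [Finset.pair_comm]
    exact key x hxy

/-- **Composition of line `tuple-ladder`.** The crux BY NAME from the four stub statements:
`engineToGHL_iff_pairsHL_imp_dimOne` + `Nat.le_induction` on `#H` from `PairsHL`. [folklore] -/
theorem EngineToGHL_of :
    (∀ t : ℕ, 2 ≤ t → (∀ H : Finset ℕ, 0 ∈ H → H.card = t → ((fun N : ℕ => ∑ n ∈ Finset.Icc 1 N, ∏ h ∈ H, ArithmeticFunction.vonMangoldt (n + h) - Literature.NumberTheory.Sieve.singularSeries ((H).image (fun h : ℕ => (h : ℤ))) * N) =o[Filter.atTop] fun N : ℕ => (N : ℝ))) → (∀ H : Finset ℕ, 0 ∈ H → H.card = t → (∀ δ : ℝ, 0 < δ → ∀ B : ℝ, ∃ C : ℝ, ∀ N : ℕ, 2 ≤ N → ∀ y r : ℕ → ℕ, (∀ d, y d ≤ N) → (∑ d ∈ Finset.Icc 1 ⌊(N : ℝ) ^ (1 - δ)⌋₊, |(∑ n ∈ (Finset.Icc 1 (y d)).filter (fun n : ℕ => n ≡ r d [MOD d]), ∏ h ∈ H, ArithmeticFunction.vonMangoldt (n + h)) - (if ∀ h ∈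 H, Nat.Coprime (r d + h) d then (((Finset.range d).filter (fun ρ : ℕ => ∀ h ∈ H, Nat.Coprime (ρ + h) d)).card : ℝ)⁻¹ else 0) * ∑ n ∈ Finset.Icc 1 (y d), ∏ h ∈ H, ArithmeticFunction.vonMangoldt (n + h)|) ≤ C * N / Real.log N ^ B)) → (∀ (H : Finset ℕ) (h : ℕ), 0 ∈ H → H.card = t → h ∉ H → (∃ ε₀ : ℝ, 0 < ε₀ ∧ ∀ A : ℝ, 0 < A → ∃ C : ℝ, ∃ N₀ : ℕ, ∀ N : ℕ, N₀ ≤ N → ∀ w y : ℕ → ℕ, (∀ q, y q ≤ N) → (∑ q ∈ Finset.Icc 1 ⌊(N : ℝ) ^ ε₀⌋₊, |∑ n ∈ (Finset.Icc 1 (y q)).filter (fun n : ℕ => n ≡ w q [MOD q]), (ArithmeticFunction.liouville (n + h) : ℝ) * ∏ h' ∈ H, ArithmeticFunction.vonMangoldt (n + h')|) ≤ C * N / Real.log N ^ A)) → ∀ H : Finset ℕ, 0 ∈ H → H.card = t + 1 → ((fun N : ℕ => ∑ n ∈ Finset.Icc 1 N, ∏ h ∈ H, ArithmeticFunction.vonMangoldt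 (n + h) - Literature.NumberTheory.Sieve.singularSeries ((H).image (fun h : ℕ => (h : ℤ))) * N) =o[Filter.atTop] fun N : ℕ => (N : ℝ))) →
    (∀ H : Finset ℕ, 0 ∈ H → 2 ≤ H.card → (∀ δ : ℝ, 0 < δ → ∀ B : ℝ, ∃ C : ℝ, ∀ N : ℕ, 2 ≤ N → ∀ y r : ℕ → ℕ, (∀ d, y d ≤ N) → (∑ d ∈ Finset.Icc 1 ⌊(N : ℝ) ^ (1 - δ)⌋₊, |(∑ n ∈ (Finset.Icc 1 (y d)).filter (fun n : ℕ => n ≡ r d [MOD d]), ∏ h ∈ H, ArithmeticFunction.vonMangoldt (n + h)) - (if ∀ h ∈ H, Nat.Coprime (r d + h) d then (((Finset.range d).filter (fun ρ : ℕ => ∀ h ∈ H, Nat.Coprime (ρ + h) d)).card : ℝ)⁻¹ else 0) * ∑ n ∈ Finset.Icc 1 (y d), ∏ h ∈ H, ArithmeticFunction.vonMangoldt (n + h)|) ≤ C * N / Real.log N ^ B)) →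
    (∀ (H : Finset ℕ) (h : ℕ), 0 ∈ H → 2 ≤ H.card → h ∉ H → (∃ ε₀ : ℝ, 0 < ε₀ ∧ ∀ A : ℝ, 0 < A → ∃ C : ℝ, ∃ N₀ : ℕ, ∀ N : ℕ, N₀ ≤ N → ∀ w y : ℕ → ℕ, (∀ q, y q ≤ N) → (∑ q ∈ Finset.Icc 1 ⌊(N : ℝ) ^ ε₀⌋₊, |∑ n ∈ (Finset.Icc 1 (y q)).filter (fun n : ℕ => n ≡ w q [MOD q]), (ArithmeticFunction.liouville (n + h) : ℝ) * ∏ h' ∈ H, ArithmeticFunction.vonMangoldt (n + h')|) ≤ C * N / Real.log N ^ A)) →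
    ((∀ H : Finset ℕ, 0 ∈ H → 2 ≤ H.card → ((fun N : ℕ => ∑ n ∈ Finset.Icc 1 N, ∏ h ∈ H, ArithmeticFunction.vonMangoldt (n + h) - Literature.NumberTheory.Sieve.singularSeries ((H).image (fun h : ℕ => (h : ℤ))) * N) =o[Filter.atTop] fun N : ℕ => (N : ℝ))) → ∀ (t L : ℕ), 1 ≤ t → ∀ ε : ℝ, 0 < ε → ∃ N₀ : ℕ, ∀ N : ℕ, N₀ ≤ N → ∀ Ψ : Fin t → Literature.NumberTheory.Sieve.AffLinForm 1, Literature.NumberTheory.Sieve.IsNondegenerateSystem Ψ → Literature.NumberTheory.Sieve.affLinSize Ψ N ≤ L → ∀ K : Set (Fin 1 → ℝ), Convex ℝ K → K ⊆ Literature.NumberTheory.Sieve.realBox 1 N → |Literature.NumberTheory.Sieve.vonMangoldtSum Ψ K N - Literature.NumberTheory.Sieve.archFactor Ψ K * Literature.NumberTheory.Sieve.singularProduct Ψ| ≤ ε * (N : ℝ)) →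
    Summit.Parity.GeneralizedHardyLittlewood.Theses.LiouvilleMAD.EngineToGHL := by
  intro h1 h2 h3 h4
  refine EngineToGHL.engineToGHL_iff_pairsHL_imp_dimOne.mpr fun hP => h4 ?_
  suffices hs : ∀ t : ℕ, 2 ≤ t → ∀ H : Finset ℕ, 0 ∈ H → H.card = t → ((fun N : ℕ => ∑ n ∈ Finset.Icc 1 N, ∏ h ∈ H, ArithmeticFunction.vonMangoldt (n + h) - Literature.NumberTheory.Sieve.singularSeries ((H).image (fun h : ℕ => (h : ℤ))) * N) =o[Filter.atTop] fun N : ℕ => (N : ℝ)) from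
    fun H h0 hc => hs H.card hc H h0 rfl
  intro t ht
  induction t, ht using Nat.le_induction with
  | base => exact hlTuple_pair_of_pairsHL hP
  | succ t ht ih =>
      exact h1 t ht ih (fun H h0 hc => h2 H h0 (hc ▸ ht))
        (fun H h h0 hc hh => h3 H h h0 (hc ▸ ht) hh)

/-- The crux, closed modulo the stubs (sorries live only in `stub_*`). [folklore] -/
theorem EngineToGHL_closed : Summit.Parity.GeneralizedHardyLittlewood.Theses.LiouvilleMAD.EngineToGHL :=
  EngineToGHL_of tupleLadder_rung tupleLevel tupleAtoms tuplesToDimOne_of_pieces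

/-- The same closure through lead c5's landed glue `Theorems.EngineToGHL.engineToGHL_of_reachInputs`
(`TupleLevel → TupleAtoms → (Reach → DimOne) → EngineToGHL`). [folklore] -/
theorem EngineToGHL_closed' : Summit.Parity.GeneralizedHardyLittlewood.Theses.LiouvilleMAD.EngineToGHL :=
  Summit.Parity.GeneralizedHardyLittlewood.Theorems.EngineToGHL.engineToGHL_of_reachInputs tupleLevel tupleAtoms
    (reachToDimOne_of_pieces dimOne_one stub_reachToDimOneTwo)

/-! ### The residuals are WEAKER than the crux (the stub set smuggles nothing upward) -/

/-- The residual stub is WEAKER than the crux (so the stub set smuggles nothing upward). [folklore] -/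
theorem tuplesToDimOne_of_engineToGHL
    (hX : Summit.Parity.GeneralizedHardyLittlewood.Theses.LiouvilleMAD.EngineToGHL) :
    (∀ H : Finset ℕ, 0 ∈ H → 2 ≤ H.card → ((fun N : ℕ => ∑ n ∈ Finset.Icc 1 N, ∏ h ∈ H, ArithmeticFunction.vonMangoldt (n + h) - Literature.NumberTheory.Sieve.singularSeries ((H).image (fun h : ℕ => (h : ℤ))) * N) =o[Filter.atTop] fun N : ℕ => (N : ℝ))) → ∀ (t L : ℕ), 1 ≤ t → ∀ ε : ℝ, 0 < ε → ∃ N₀ : ℕ, ∀ N : ℕ, N₀ ≤ N → ∀ Ψ : Fin t → Literature.NumberTheory.Sieve.AffLinForm 1, Literature.NumberTheory.Sieve.IsNondegenerateSystem Ψ → Literature.NumberTheory.Sieve.affLinSize Ψ N ≤ L → ∀ K : Set (Fin 1 → ℝ), Convex ℝ K → K ⊆ Literature.NumberTheory.Sieve.realBox 1 N → |Literature.NumberTheory.Sieve.vonMangoldtSum Ψ K N - Literature.NumberTheory.Sieve.archFactor Ψ K * Literature.NumberTheory.Sieve.singularProduct Ψ| ≤ ε * (N : ℝ) := by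
  intro hT
  refine EngineToGHL.engineToGHL_iff_pairsHL_imp_dimOne.mp hX ?_
  intro k hk
  have h0k : (0 : ℕ) ≠ k := by omega
  have himg : (({0, k} : Finset ℕ).image (fun h : ℕ => (h : ℤ))) = ({0, (k : ℤ)} : Finset ℤ) := by
    simp [Finset.image_insert, Finset.image_singleton]
  have hprod : ∀ n : ℕ, ∏ h ∈ ({0, k} : Finset ℕ), ArithmeticFunction.vonMangoldt (n + h) =
      ArithmeticFunction.vonMangoldt n * ArithmeticFunction.vonMangoldt (n + k) := by
    intro n
    rw [Finset.prod_pair h0k, Nat.add_zero]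
  have := hT ({0, k} : Finset ℕ) (by simp) (by rw [Finset.card_pair h0k])
  simpa only [hprod, himg] using this

/-- The reach (already its `t = 2`, `Hb`-bounded part) contains `PairsHL` (c1's `pairsHL_of_pairsReach`), so the new
residual `Reach → DimOne` follows from the crux `EngineToGHL ↔ (PairsHL → DimOne)`. [folklore] -/
theorem reachToDimOne_of_engineToGHL
    (hX : Summit.Parity.GeneralizedHardyLittlewood.Theses.LiouvilleMAD.EngineToGHL) :
    (∀ (t Hb L : ℕ) (ε : ℝ), 2 ≤ t → 0 < ε → ∃ N₀ : ℕ, ∀ N : ℕ, N₀ ≤ N → ∀ Ψ : Fin t → Literature.NumberTheory.Sieve.AffLinForm 1, Literature.NumberTheory.Sieve.IsNondegenerateSystem Ψ → Literature.NumberTheory.Sieve.affLinSize Ψ N ≤ L → (∀ i j, (Ψ i).coeff j = 1) → (∀ i j, |(Ψ i).const - (Ψ j).const| ≤ (Hb : ℤ)) → ∀ K : Set (Fin 1 → ℝ), Convex ℝ K → K ⊆ Literature.NumberTheory.Sieve.realBox 1 N → |Literature.NumberTheory.Sieve.vonMangoldtSum Ψ K N - Literature.NumberTheory.Sieve.archFactor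 Ψ K * Literature.NumberTheory.Sieve.singularProduct Ψ| ≤ ε * (N : ℝ)) → ∀ (t L : ℕ), 1 ≤ t → ∀ ε : ℝ, 0 < ε → ∃ N₀ : ℕ, ∀ N : ℕ, N₀ ≤ N → ∀ Ψ : Fin t → Literature.NumberTheory.Sieve.AffLinForm 1, Literature.NumberTheory.Sieve.IsNondegenerateSystem Ψ → Literature.NumberTheory.Sieve.affLinSize Ψ N ≤ L → ∀ K : Set (Fin 1 → ℝ), Convex ℝ K → K ⊆ Literature.NumberTheory.Sieve.realBox 1 N → |Literature.NumberTheory.Sieve.vonMangoldtSum Ψ K N - Literature.NumberTheory.Sieve.archFactor Ψ K * Literature.NumberTheory.Sieve.singularProduct Ψ| ≤ ε * (N : ℝ) := by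
  intro hR
  refine EngineToGHL.engineToGHL_iff_pairsHL_imp_dimOne.mp hX (EngineToGHL.pairsHL_of_pairsReach ?_)
  intro Hb L ε hε
  obtain ⟨N₀, hN₀⟩ := hR 2 Hb L ε le_rfl hε
  refine ⟨N₀, fun N hN Ψ hnd hL hcoeff hHb K hK hKN => hN₀ N hN Ψ hnd hL hcoeff ?_ K hK hKN⟩
  intro i j
  fin_cases i <;> fin_cases j
  · simp
  · simpa [abs_sub_comm] using hHb
  · simpa using hHb
  · simp

/-- The NEW residual `stub_reachToDimOneTwo` is WEAKER than the crux (it is v5's residual restricted to `t ≥ 2`).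
[folklore] -/
theorem reachToDimOneTwo_of_engineToGHL
    (hX : Summit.Parity.GeneralizedHardyLittlewood.Theses.LiouvilleMAD.EngineToGHL) :
    (∀ (t Hb L : ℕ) (ε : ℝ), 2 ≤ t → 0 < ε → ∃ N₀ : ℕ, ∀ N : ℕ, N₀ ≤ N → ∀ Ψ : Fin t → Literature.NumberTheory.Sieve.AffLinForm 1, Literature.NumberTheory.Sieve.IsNondegenerateSystem Ψ → Literature.NumberTheory.Sieve.affLinSize Ψ N ≤ L → (∀ i j, (Ψ i).coeff j = 1) → (∀ i j, |(Ψ i).const - (Ψ j).const| ≤ (Hb : ℤ)) → ∀ K : Set (Fin 1 → ℝ), Convex ℝ K → K ⊆ Literature.NumberTheory.Sieve.realBox 1 N → |Literature.NumberTheory.Sieve.vonMangoldtSum Ψ K N - Literature.NumberTheory.Sieve.archFactor Ψ K * Literature.NumberTheory.Sieve.singularProduct Ψ| ≤ ε * (N : ℝ)) → ∀ (t L : ℕ), 2 ≤ t → ∀ ε : ℝ, 0 < ε → ∃ N₀ : ℕ, ∀ N : ℕ, N₀ ≤ N → ∀ Ψ : Fin t → Literature.NumberTheory.Sieve.AffLinForm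 1, Literature.NumberTheory.Sieve.IsNondegenerateSystem Ψ → Literature.NumberTheory.Sieve.affLinSize Ψ N ≤ L → ∀ K : Set (Fin 1 → ℝ), Convex ℝ K → K ⊆ Literature.NumberTheory.Sieve.realBox 1 N → |Literature.NumberTheory.Sieve.vonMangoldtSum Ψ K N - Literature.NumberTheory.Sieve.archFactor Ψ K * Literature.NumberTheory.Sieve.singularProduct Ψ| ≤ ε * (N : ℝ) :=
  fun hR t L ht ε hε => reachToDimOne_of_engineToGHL hX hR t L (by omega) ε hε

end Summit.Parity.GeneralizedHardyLittlewood.Cruxes.EngineToGHL.TupleLadder
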